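import Mathlib
import Summits.NavierStokesRegularity.NavierStokesRegularity.Theorems.EulerZoomLiouvillePowerGaugeEulerLiouvilleSelfSimilarShiftedUniformlyContinuous
import Literature.Analysis.FluidPDE.SpaceTimeRescaling
import HarnessLib

/-!
# PAST-EXACT self-similarity: members of crux E that are exactly self-similar about `(T, x₀)` only on a past sub-slab
# `(−∞, T₁)`, `T₁ ≤ 0`, `T₁ ≤ T` — the origin-centred extension and the large-scale `A`-gauge read from the far past
# (crux `EulerZoomLiouville.PowerGaugeEulerLiouville` = stmt-NavierStokesRegularity-19832, line `birth`, rung C1)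

Route `EulerZoomLiouville` (NavierStokesRegularity).  Interim LEAD ns-typeII-p2 g9.  The SHIFTED strata (`…ShiftedExtension` p589186,
`…ShiftedUniformlyContinuous` p590934, …) assume exact self-similarity about `(T, x₀)` at ALL times `τ < 0` (hence `T ≥ 0`).  Both inputs of
those strata — the origin-centred EXTENSION and the large-scale `A`-gauge reading — use the member only in the far past; this file proves
them for members that are exactly self-similar on a PAST SUB-SLAB `τ < T₁` only (`T₁ ≤ 0`, `T₁ ≤ T`; the member is ARBITRARY on `[T₁, 0)`):
in particular a self-similar Euler blow-up at an INTERIOR time `T < 0` of the slab followed by ANY weak continuation (non-uniqueness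
territory), or an exactly self-similar far past followed by anything.

* `Shifted.isDistributional_selfSimilarCollapse_of_past` — distributional Euler pair on the slab, `u(τ,x) = (T−τ)^{γ−1}V((T−τ)^{−γ}(x − x₀))`
  and `p` likewise for `τ < T₁` ⇒ `(selfSimilarCollapse γ 0 V, selfSimilarCollapsePressure γ 0 P)` is a distributional Euler pair on the whole
  slab (restriction to `(−∞, T₁)`, similarity scaling `(s,y) ↦ (T+βs, x₀+β^γ y)` with `β = (T−T₁)/(−b) + 1`, locality in time);
* `Shifted.profile_energy_growth_of_gaugeA_past` — `0 < ρ ≤ ½`: `∫_{B_L}‖V‖² ≤ C L^{1−2ρ}` for `L ≥ 2 − T₁` (the gauge read on the far-past slice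
  `τ = T₁ − 1`, radius `L(T−T₁+1)^γ + ‖x₀‖`);
* `Shifted.growth_of_growth_le` — all-scales patch from any threshold `L₀ ≥ 1` for continuous profiles (generalises `growth_of_growth_two_le`).

Consequence (sequel `…SelfSimilarPastStrata`): a past-exact member with a TAME `C²` profile has profile `0`, hence VANISHES ON `(−∞, T₁)`, hence
has a quiescent past, hence is trivial by the crux's filled stub `stub_quiescentPast` (`ae_eq_zero_of_gauge_of_energyVanishing_allRho`).
WHAT THIS IS NOT: not NS, not E — transport lemmas `--supports` stmt-19832. [folklore]
-/

noncomputable section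

-- flat `Theorems/<Route><Decl>…` files of one crux share the namespace of the crux (tree convention: `Summit.<S>.<S>.…`)
set_option linter.dupNamespace false

open MeasureTheory Set Filter Topology Metric Function TopologicalSpace
open scoped ENNReal NNReal

namespace Summit.NavierStokesRegularity.NavierStokesRegularity.Theorems.PowerGaugeEulerLiouville

open Literature.Analysis Literature.Analysis.FunctionSpaces Literature.Analysis.FluidPDE

namespace Shifted

/-! ### The origin-centred extension from a past sub-slab -/

/-- **THE ORIGIN-CENTRED EXTENSION OF A PAST-EXACT SELF-SIMILAR MEMBER IS A DISTRIBUTIONAL EULER PAIR ON THE WHOLE SLAB.**  Let `(u, p)`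
be a distributional Euler pair on `(−∞,0) × ℝ³` which is exactly self-similar about `(T, x₀)` with exponent `γ` and profile `(V, P)` FOR
`τ < T₁` only, where `T₁ ≤ 0` and `T₁ ≤ T`.  Then `(selfSimilarCollapse γ 0 V, selfSimilarCollapsePressure γ 0 P)` is a distributional Euler
pair on `(−∞,0) × ℝ³` (`isDistributional_selfSimilarCollapse_of_shifted` is the case `T₁ = 0`). [folklore] -/
theorem isDistributional_selfSimilarCollapse_of_past {γ T T₁ : ℝ} (hT₁ : T₁ ≤ 0) (hTT₁ : T₁ ≤ T)
    (x₀ : EuclideanSpace ℝ (Fin 3))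
    {u : ℝ → EuclideanSpace ℝ (Fin 3) → EuclideanSpace ℝ (Fin 3)} {p : ℝ → EuclideanSpace ℝ (Fin 3) → ℝ}
    (hsol : IsDistributionalNSSolutionOn (slab (EuclideanSpace ℝ (Fin 3)) (Iio 0) isOpen_Iio) 0 0 u p)
    {V : EuclideanSpace ℝ (Fin 3) → EuclideanSpace ℝ (Fin 3)} {P : EuclideanSpace ℝ (Fin 3) → ℝ}
    (hu : ∀ τ : ℝ, τ < T₁ → u τ = fun x => selfSimilarCollapse γ T V τ (x - x₀))
    (hp : ∀ τ : ℝ, τ < T₁ → p τ = fun x => selfSimilarCollapsePressure γ T P τ (x - x₀)) :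
    IsDistributionalNSSolutionOn (slab (EuclideanSpace ℝ (Fin 3)) (Iio 0) isOpen_Iio) 0 0
      (selfSimilarCollapse γ 0 V) (selfSimilarCollapsePressure γ 0 P) := by
  refine isDistributional_slab_Iio_zero_of_forall fun b hb => ?_
  -- ### the similarity scaling that brings the self-similar era below `b`
  have hb' : 0 < -b := neg_pos.2 hb
  set β : ℝ := (T - T₁) / (-b) + 1 with hβdef
  have hβ : 0 < β := by
    have : 0 ≤ (T - T₁) / (-b) := div_nonneg (by linarith) hb'.le
    rw [hβdef]; linarith
  set lam : ℝ := β ^ γ with hlamdef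
  set α : ℝ := β ^ (1 - γ) with hαdef
  have hlam : 0 < lam := Real.rpow_pos_of_pos hβ _
  have hα : 0 < α := Real.rpow_pos_of_pos hβ _
  have hαβ : β = α * lam := by
    rw [hαdef, hlamdef, ← Real.rpow_add hβ, show (1 - γ) + γ = 1 by ring, Real.rpow_one]
  -- ### covariance
  have h1 := hsol.stRescale hα hlam hαβ T x₀
  have hf0 : ((α ^ 2 * lam) • stPull β lam T x₀ (0 : ℝ → EuclideanSpace ℝ (Fin 3) → EuclideanSpace ℝ (Fin 3))) = 0 := by
    funext s y
    simp [stPull]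
  rw [mul_zero, zero_div, hf0] at h1
  -- ### restriction to the slab `(−∞, b)`, which the scaling maps into the self-similar era `τ < T₁`
  have hβb : β * b = -(T - T₁) + b := by
    rw [hβdef, add_mul, one_mul, div_neg, neg_mul, div_mul_cancel₀ (T - T₁) hb.ne]
  have htime : ∀ z : ℝ × EuclideanSpace ℝ (Fin 3),
      z ∈ (((slab (EuclideanSpace ℝ (Fin 3)) (Iio b) isOpen_Iio : Opens (ℝ × EuclideanSpace ℝ (Fin 3))) :
        Set (ℝ × EuclideanSpace ℝ (Fin 3)))) → T + β * z.1 < T₁ ∧ 0 < -z.1 := by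
    intro z hz
    rw [SetLike.mem_coe, mem_slab, mem_Iio] at hz
    have : β * z.1 < β * b := mul_lt_mul_of_pos_left hz hβ
    exact ⟨by linarith, by linarith⟩
  have hle : slab (EuclideanSpace ℝ (Fin 3)) (Iio b) isOpen_Iio ≤
      stPreimage β lam T x₀ (slab (EuclideanSpace ℝ (Fin 3)) (Iio 0) isOpen_Iio) := by
    intro z hz
    rw [mem_stPreimage, mem_slab, stAffine_fst, mem_Iio]
    have := (htime z hz).1
    linarith
  have h2 := h1.of_le hle
  -- ### on `(−∞, b)` the rescaled pair IS the origin-centred collapse of the same profile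
  have hmeas : MeasurableSet (((slab (EuclideanSpace ℝ (Fin 3)) (Iio b) isOpen_Iio :
      Opens (ℝ × EuclideanSpace ℝ (Fin 3))) : Set (ℝ × EuclideanSpace ℝ (Fin 3)))) :=
    (slab (EuclideanSpace ℝ (Fin 3)) (Iio b) isOpen_Iio).isOpen.measurableSet
  refine h2.congr_ae ((ae_restrict_iff' hmeas).2 (ae_of_all _ fun z hz => ?_))
    ((ae_restrict_iff' hmeas).2 (ae_of_all _ fun z hz => ?_))
  · obtain ⟨hτ, hs⟩ := htime z hz
    show (α • stPull β lam T x₀ u) z.1 z.2 = selfSimilarCollapse γ 0 V z.1 z.2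
    rw [smul_stPull_apply, hu _ hτ]
    simp only [selfSimilarCollapse_apply, add_sub_cancel_left, zero_sub, smul_smul]
    rw [show T - (T + β * z.1) = β * (-z.1) by ring, rpow_one_sub_mul_mul_rpow hβ hs,
      mul_rpow_neg_mul_rpow hβ hs]
  · obtain ⟨hτ, hs⟩ := htime z hz
    show (α ^ 2 • stPull β lam T x₀ p) z.1 z.2 = selfSimilarCollapsePressure γ 0 P z.1 z.2
    rw [smul_stPull_apply, hp _ hτ]
    simp only [selfSimilarCollapsePressure_apply, add_sub_cancel_left, zero_sub, smul_smul, smul_eq_mul]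
    rw [show T - (T + β * z.1) = β * (-z.1) by ring, ← mul_assoc, rpow_one_sub_sq_mul_mul_rpow hβ hs,
      mul_rpow_neg_mul_rpow hβ hs]

/-! ### The `A`-gauge read from the far past -/

/-- **THE `A`-GAUGE OF A PAST-EXACT MEMBER IN PROFILE VARIABLES (large scales).**  If `u(τ, x) = (T−τ)^{γ−1} V((T−τ)^{−γ}(x − x₀))` for
`τ < T₁` (`γ = 1/(2+ρ)`, `0 < ρ ≤ ½`, `T₁ ≤ 0`, `T₁ ≤ T`) and `a^{2ρ} A(a; 0) ≤ c` for all `a > 0`, then for some `C < ∞`: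
`∫_{B_L} ‖V‖² ≤ C L^{1−2ρ}` for every `L ≥ 2 − T₁` (the gauge on the far-past slice `τ = T₁ − 1` at radius `a = L(T−T₁+1)^γ + ‖x₀‖`, whose
square exceeds `1 − T₁`, and the space change of variables `y ↦ x₀ + (T−T₁+1)^γ y`).  `profile_energy_growth_of_gaugeA` (this namespace) is the case
`T₁ = 0`. [folklore] -/
theorem profile_energy_growth_of_gaugeA_past {ρ : ℝ} (hρ : 0 < ρ) (hρh : ρ ≤ 1 / 2) {T T₁ : ℝ} (hT₁ : T₁ ≤ 0) (hTT₁ : T₁ ≤ T)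
    (x₀ : EuclideanSpace ℝ (Fin 3))
    {u : ℝ → EuclideanSpace ℝ (Fin 3) → EuclideanSpace ℝ (Fin 3)}
    {V : EuclideanSpace ℝ (Fin 3) → EuclideanSpace ℝ (Fin 3)} {c : ℝ≥0}
    (hu : ∀ τ : ℝ, τ < T₁ → u τ = fun x => selfSimilarCollapse (1 / (2 + ρ)) T V τ (x - x₀))
    (hA : ∀ a : ℝ, 0 < a → ENNReal.ofReal (a ^ (2 * ρ)) *
      cknA a (0 : ℝ × EuclideanSpace ℝ (Fin 3)) u ≤ (c : ℝ≥0∞)) :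
    ∃ C : ℝ≥0∞, C ≠ ⊤ ∧ ∀ L : ℝ, 2 - T₁ ≤ L →
      ∫⁻ y in ball (0 : EuclideanSpace ℝ (Fin 3)) L, ‖V y‖ₑ ^ 2 ≤ C * ENNReal.ofReal (L ^ (1 - 2 * ρ)) := by
  set γ : ℝ := 1 / (2 + ρ) with hγ
  -- the far-past slice `τ₁ = T₁ − 1` and `s = T − τ₁ ≥ 1`
  set τ₁ : ℝ := T₁ - 1 with hτ₁
  set s : ℝ := T - T₁ + 1 with hs
  have hs0 : 0 < s := by rw [hs]; linarith
  have hsτ : T - τ₁ = s := by rw [hτ₁, hs]; ring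
  set σ : ℝ := s ^ γ with hσ
  have hσ0 : 0 < σ := Real.rpow_pos_of_pos hs0 _
  have h12ρ : 0 ≤ 1 - 2 * ρ := by linarith
  set k : ℝ := s ^ (2 - 2 * γ) * (σ ^ 3)⁻¹ * (σ + ‖x₀‖) ^ (1 - 2 * ρ) with hk
  refine ⟨ENNReal.ofReal k * (c : ℝ≥0∞), ENNReal.mul_ne_top ENNReal.ofReal_ne_top ENNReal.coe_ne_top, fun L hL => ?_⟩
  have hL2 : 2 ≤ L := by linarith
  have hL0 : 0 < L := by linarith
  -- the radius `a`
  set a : ℝ := L * σ + ‖x₀‖ with ha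
  have hσ1 : 1 ≤ σ := by
    rw [hσ]; exact Real.one_le_rpow (by rw [hs]; linarith) (by rw [hγ]; positivity)
  have haL : L ≤ a := by
    have : L * 1 ≤ L * σ := mul_le_mul_of_nonneg_left hσ1 hL0.le
    have := norm_nonneg x₀
    rw [ha]; linarith
  have ha0 : 0 < a := by linarith
  have ha2 : 1 - T₁ < a ^ 2 := by nlinarith
  have hτ : τ₁ ∈ Ioo ((0 : ℝ × EuclideanSpace ℝ (Fin 3)).1 - a ^ 2) (0 : ℝ × EuclideanSpace ℝ (Fin 3)).1 := by
    simp only [Prod.fst_zero, zero_sub, mem_Ioo]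
    constructor <;> [rw [hτ₁]; rw [hτ₁]] <;> linarith
  have hslice : (ENNReal.ofReal a)⁻¹ * ∫⁻ x in ball (0 : EuclideanSpace ℝ (Fin 3)) a, ‖u τ₁ x‖ₑ ^ 2 ≤
      cknA a (0 : ℝ × EuclideanSpace ℝ (Fin 3)) u := by
    unfold cknA
    exact le_iSup₂ (f := fun t (_ : t ∈ Ioo ((0 : ℝ × EuclideanSpace ℝ (Fin 3)).1 - a ^ 2)
        (0 : ℝ × EuclideanSpace ℝ (Fin 3)).1) =>
        (ENNReal.ofReal a)⁻¹ * ∫⁻ x in ball (0 : ℝ × EuclideanSpace ℝ (Fin 3)).2 a, ‖u t x‖ₑ ^ 2) τ₁ hτ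
  set I : ℝ≥0∞ := ∫⁻ x in ball (0 : EuclideanSpace ℝ (Fin 3)) a, ‖u τ₁ x‖ₑ ^ 2 with hI
  have hgauge : ENNReal.ofReal (a ^ (2 * ρ)) * ((ENNReal.ofReal a)⁻¹ * I) ≤ (c : ℝ≥0∞) :=
    calc ENNReal.ofReal (a ^ (2 * ρ)) * ((ENNReal.ofReal a)⁻¹ * I)
        ≤ ENNReal.ofReal (a ^ (2 * ρ)) * cknA a (0 : ℝ × EuclideanSpace ℝ (Fin 3)) u := by gcongr
      _ ≤ (c : ℝ≥0∞) := hA a ha0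
  have hKa : ENNReal.ofReal (a ^ (2 * ρ)) * (ENNReal.ofReal a)⁻¹ = ENNReal.ofReal (a ^ (2 * ρ - 1)) := by
    rw [← ENNReal.ofReal_inv_of_pos ha0, ← ENNReal.ofReal_mul (by positivity), Real.rpow_sub_one ha0.ne',
      div_eq_mul_inv]
  have hIle : I ≤ ENNReal.ofReal (a ^ (1 - 2 * ρ)) * (c : ℝ≥0∞) := by
    have hunit : ENNReal.ofReal (a ^ (1 - 2 * ρ)) * ENNReal.ofReal (a ^ (2 * ρ - 1)) = 1 := by
      rw [← ENNReal.ofReal_mul (by positivity), ← Real.rpow_add ha0, show (1 - 2 * ρ) + (2 * ρ - 1) = 0 by ring,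
        Real.rpow_zero, ENNReal.ofReal_one]
    calc I = ENNReal.ofReal (a ^ (1 - 2 * ρ)) * (ENNReal.ofReal (a ^ (2 * ρ - 1)) * I) := by
          rw [← mul_assoc, hunit, one_mul]
      _ = ENNReal.ofReal (a ^ (1 - 2 * ρ)) * (ENNReal.ofReal (a ^ (2 * ρ)) * ((ENNReal.ofReal a)⁻¹ * I)) := by
          rw [← mul_assoc (ENNReal.ofReal (a ^ (2 * ρ))), hKa]
      _ ≤ ENNReal.ofReal (a ^ (1 - 2 * ρ)) * (c : ℝ≥0∞) := by gcongr
  -- ### change of variables `x = x₀ + σ y` on the far-past slice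
  have hval : ∀ y : EuclideanSpace ℝ (Fin 3),
      ‖u τ₁ (x₀ + σ • y)‖ₑ ^ 2 = ENNReal.ofReal (s ^ (2 * (γ - 1))) * ‖V y‖ₑ ^ 2 := by
    intro y
    rw [hu τ₁ (by rw [hτ₁]; linarith)]
    simp only [selfSimilarCollapse_apply, add_sub_cancel_left, smul_smul]
    rw [hsτ, hσ, ← Real.rpow_add hs0, show -γ + γ = 0 by ring, Real.rpow_zero,
      one_smul, enorm_smul, mul_pow, Real.enorm_eq_ofReal (Real.rpow_nonneg hs0.le _),
      ← ENNReal.ofReal_pow (Real.rpow_nonneg hs0.le _), ← Real.rpow_natCast (s ^ (γ - 1)) 2,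
      ← Real.rpow_mul hs0.le, show (γ - 1) * ((2 : ℕ) : ℝ) = 2 * (γ - 1) by push_cast; ring]
  have hpre : ball (0 : EuclideanSpace ℝ (Fin 3)) L ⊆
      (fun y : EuclideanSpace ℝ (Fin 3) => x₀ + σ • y) ⁻¹' ball (0 : EuclideanSpace ℝ (Fin 3)) a := by
    intro y hy
    rw [mem_ball_zero_iff] at hy
    rw [mem_preimage, mem_ball_zero_iff]
    calc ‖x₀ + σ • y‖ ≤ ‖x₀‖ + ‖σ • y‖ := norm_add_le _ _
      _ = ‖x₀‖ + σ * ‖y‖ := by rw [norm_smul, Real.norm_of_nonneg hσ0.le]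
      _ < ‖x₀‖ + σ * L := by gcongr
      _ = a := by rw [ha]; ring
  have hcov := setLIntegral_preimage_comp_space_affine hσ0 x₀
    (fun x : EuclideanSpace ℝ (Fin 3) => ‖u τ₁ x‖ₑ ^ 2) (ball (0 : EuclideanSpace ℝ (Fin 3)) a)
  rw [finrank_euclideanSpace_fin] at hcov
  have hmain : ENNReal.ofReal (s ^ (2 * (γ - 1))) * ∫⁻ y in ball (0 : EuclideanSpace ℝ (Fin 3)) L, ‖V y‖ₑ ^ 2 ≤
      ENNReal.ofReal (σ ^ 3)⁻¹ * I := by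
    rw [← hcov, ← lintegral_const_mul' _ _ ENNReal.ofReal_ne_top]
    calc ∫⁻ y in ball (0 : EuclideanSpace ℝ (Fin 3)) L, ENNReal.ofReal (s ^ (2 * (γ - 1))) * ‖V y‖ₑ ^ 2
        = ∫⁻ y in ball (0 : EuclideanSpace ℝ (Fin 3)) L, ‖u τ₁ (x₀ + σ • y)‖ₑ ^ 2 :=
          lintegral_congr fun y => (hval y).symm
      _ ≤ ∫⁻ y in (fun y : EuclideanSpace ℝ (Fin 3) => x₀ + σ • y) ⁻¹' ball (0 : EuclideanSpace ℝ (Fin 3)) a,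
            ‖u τ₁ (x₀ + σ • y)‖ₑ ^ 2 := lintegral_mono_set hpre
  -- ### assemble
  have haL' : a ^ (1 - 2 * ρ) ≤ (σ + ‖x₀‖) ^ (1 - 2 * ρ) * L ^ (1 - 2 * ρ) := by
    rw [← Real.mul_rpow (by positivity) hL0.le]
    refine Real.rpow_le_rpow ha0.le ?_ h12ρ
    have : ‖x₀‖ ≤ ‖x₀‖ * L := le_mul_of_one_le_right (norm_nonneg _) (by linarith)
    rw [ha]; nlinarith
  have hunit2 : ENNReal.ofReal (s ^ (2 - 2 * γ)) * ENNReal.ofReal (s ^ (2 * (γ - 1))) = 1 := by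
    rw [← ENNReal.ofReal_mul (Real.rpow_nonneg hs0.le _), ← Real.rpow_add hs0,
      show (2 - 2 * γ) + 2 * (γ - 1) = 0 by ring, Real.rpow_zero, ENNReal.ofReal_one]
  calc ∫⁻ y in ball (0 : EuclideanSpace ℝ (Fin 3)) L, ‖V y‖ₑ ^ 2
      = ENNReal.ofReal (s ^ (2 - 2 * γ)) *
          (ENNReal.ofReal (s ^ (2 * (γ - 1))) * ∫⁻ y in ball (0 : EuclideanSpace ℝ (Fin 3)) L, ‖V y‖ₑ ^ 2) := by
        rw [← mul_assoc, hunit2, one_mul]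
    _ ≤ ENNReal.ofReal (s ^ (2 - 2 * γ)) * (ENNReal.ofReal (σ ^ 3)⁻¹ * I) := by gcongr
    _ ≤ ENNReal.ofReal (s ^ (2 - 2 * γ)) * (ENNReal.ofReal (σ ^ 3)⁻¹ *
          (ENNReal.ofReal (a ^ (1 - 2 * ρ)) * (c : ℝ≥0∞))) := by gcongr
    _ ≤ ENNReal.ofReal (s ^ (2 - 2 * γ)) * (ENNReal.ofReal (σ ^ 3)⁻¹ *
          (ENNReal.ofReal ((σ + ‖x₀‖) ^ (1 - 2 * ρ) * L ^ (1 - 2 * ρ)) * (c : ℝ≥0∞))) := by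
        gcongr
    _ = ENNReal.ofReal k * (c : ℝ≥0∞) * ENNReal.ofReal (L ^ (1 - 2 * ρ)) := by
        rw [hk, ENNReal.ofReal_mul (by positivity), ENNReal.ofReal_mul (by positivity),
          ENNReal.ofReal_mul (by positivity)]
        ring

/-- **From large scales to all scales, general threshold.**  A continuous profile with `∫_{B_L}‖V‖² ≤ C L^θ` for `L ≥ L₀` (`C < ∞`, `θ ≤ 3`,
`L₀ ≥ 1`) satisfies `∫_{B_L}‖V‖² ≤ C' L^θ` for ALL `L > 0` with `C' = C + M² L₀^{3−θ}|B₁| < ∞`, `M` a bound of `‖V‖` on the closed ball of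
radius `L₀` (generalises `growth_of_growth_two_le`). [folklore] -/
theorem growth_of_growth_le {V : EuclideanSpace ℝ (Fin 3) → EuclideanSpace ℝ (Fin 3)} (hVc : Continuous V)
    {θ : ℝ} (hθ3 : θ ≤ 3) {L₀ : ℝ} (hL₀ : 1 ≤ L₀) {C : ℝ≥0∞} (hC : C ≠ ⊤)
    (hA : ∀ L : ℝ, L₀ ≤ L → ∫⁻ y in ball (0 : EuclideanSpace ℝ (Fin 3)) L, ‖V y‖ₑ ^ 2 ≤ C * ENNReal.ofReal (L ^ θ)) :
    ∃ C' : ℝ≥0∞, C' ≠ ⊤ ∧ ∀ L : ℝ, 0 < L →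
      ∫⁻ y in ball (0 : EuclideanSpace ℝ (Fin 3)) L, ‖V y‖ₑ ^ 2 ≤ C' * ENNReal.ofReal (L ^ θ) := by
  obtain ⟨M, hM⟩ := (isCompact_closedBall (0 : EuclideanSpace ℝ (Fin 3)) L₀).exists_bound_of_continuousOn
    hVc.continuousOn
  have hL₀0 : 0 < L₀ := by linarith
  set v₁ : ℝ≥0∞ := volume (ball (0 : EuclideanSpace ℝ (Fin 3)) 1) with hv₁
  have hv₁top : v₁ ≠ ⊤ := measure_ball_lt_top.ne
  set C₂ : ℝ≥0∞ := ENNReal.ofReal (M ^ 2 * L₀ ^ (3 - θ)) * v₁ with hC₂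
  refine ⟨C + C₂, ENNReal.add_ne_top.2 ⟨hC, ENNReal.mul_ne_top ENNReal.ofReal_ne_top hv₁top⟩, fun L hL => ?_⟩
  by_cases hLL : L₀ ≤ L
  · exact (hA L hLL).trans (by gcongr; exact le_self_add)
  · push Not at hLL
    have hpt : ∀ y ∈ ball (0 : EuclideanSpace ℝ (Fin 3)) L, ‖V y‖ₑ ^ 2 ≤ ENNReal.ofReal (M ^ 2) := by
      intro y hy
      have hy2 : y ∈ closedBall (0 : EuclideanSpace ℝ (Fin 3)) L₀ :=
        mem_closedBall.2 ((mem_ball.1 hy).le.trans hLL.le)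
      rw [← ofReal_norm, ← ENNReal.ofReal_pow (norm_nonneg _)]
      exact ENNReal.ofReal_le_ofReal (pow_le_pow_left₀ (norm_nonneg _) (hM y hy2) 2)
    have h1 : ∫⁻ y in ball (0 : EuclideanSpace ℝ (Fin 3)) L, ‖V y‖ₑ ^ 2 ≤
        ENNReal.ofReal (M ^ 2) * volume (ball (0 : EuclideanSpace ℝ (Fin 3)) L) := by
      calc ∫⁻ y in ball (0 : EuclideanSpace ℝ (Fin 3)) L, ‖V y‖ₑ ^ 2
          ≤ ∫⁻ _ in ball (0 : EuclideanSpace ℝ (Fin 3)) L, ENNReal.ofReal (M ^ 2) :=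
            setLIntegral_mono' measurableSet_ball hpt
        _ = ENNReal.ofReal (M ^ 2) * volume (ball (0 : EuclideanSpace ℝ (Fin 3)) L) := setLIntegral_const _ _
    rw [Measure.addHaar_ball_of_pos volume 0 hL, finrank_euclideanSpace_fin] at h1
    have hL3 : L ^ (3 : ℕ) ≤ L₀ ^ (3 - θ) * L ^ θ := by
      rw [← Real.rpow_natCast L 3, show ((3 : ℕ) : ℝ) = (3 - θ) + θ by push_cast; ring, Real.rpow_add hL]
      exact mul_le_mul_of_nonneg_right (Real.rpow_le_rpow hL.le hLL.le (by linarith)) (Real.rpow_nonneg hL.le _)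
    calc ∫⁻ y in ball (0 : EuclideanSpace ℝ (Fin 3)) L, ‖V y‖ₑ ^ 2
        ≤ ENNReal.ofReal (M ^ 2) * (ENNReal.ofReal (L ^ (3 : ℕ)) * v₁) := h1
      _ ≤ ENNReal.ofReal (M ^ 2) * (ENNReal.ofReal (L₀ ^ (3 - θ) * L ^ θ) * v₁) := by gcongr
      _ = C₂ * ENNReal.ofReal (L ^ θ) := by
          rw [hC₂, ENNReal.ofReal_mul (by positivity), ENNReal.ofReal_mul (by positivity)]; ring
      _ ≤ (C + C₂) * ENNReal.ofReal (L ^ θ) := by gcongr; exact le_add_self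

end Shifted

end Summit.NavierStokesRegularity.NavierStokesRegularity.Theorems.PowerGaugeEulerLiouville

end
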